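import Summits.QuantumAdvantage.AdviceFreeQNC0.AffBells24ExposedSupport
import HarnessLib

/-!
# Sketch25 — the 𝔽₄ tensor-basis calculus for exact test relations (qa-qnc0-p1 gen 25, ROUND-24 §2)

(VERBATIM copy of `HOME/qa-qnc0-p1/exp25/Sketch25.lean`, authored by the planner seat qn-p1 g25 (statements + PROVED glue),
farm rc 0 / 0 sorry; landed by the prover seat qn-prover-3 g13 as the typed tree targets of asks P-25a/b and the revised P-25
(`StrongFullSupportRigidityLin`, Theorem B′); only this paragraph, the `HarnessLib` import and one docstring are new.  The lower
bound side — the symmetric relations, `¬ FullSupportRigidity (Z₀+1) Z₀` for every `Z₀ ≥ 3` — is PROVED in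
`AffBells25SymmetricRelations.lean`.)

Typed targets for prover-3 (P-25a/b).  All statements are over the `AffBells24` definitions already in the
tree (`test`, `xorTests`, `parityClass`, `FullSupportRigidity`).  Nothing here is a route item.

* `Balanced γ c`        — R1-triviality: in every parallel class `{±γ g₀}` the signed-residue counts are
                           pairwise congruent mod 2.
* `ClassToCube`         — a relation (constant XOR) on a parity class with `4·3^K < Z` is a relation on the
                           whole cube (pigeonhole: 5 coins on which every row is constant; 3-flip moves).
* `FullCubeLemma`       — a relation on the whole cube among `K < 2^(Z-1)` full-support tests is balanced
                           (𝔽₄-valued tensor basis `Φ_δ = ω^{⟨δ,y⟩}`, `δ ∈ {1,2}^Z`).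
* `StrongFullSupportRigidity` — both together; implies `FullSupportRigidity K₀ (4·3^K₀+1)` for every `K₀`
                           (proved below: `fullSupportRigidity_of_strong`).
-/

namespace Summit.QuantumAdvantage.AdviceFreeQNC0

namespace AffBells25

open Finset AffBells24

/-- Signed-residue count of the parallel class of row `g₀`: rows equal to `γ g₀` with residue `r`, plus rows
equal to `-γ g₀` with residue `-r` (the same test written with the opposite sign). -/
def classCount {Z K : ℕ} (γ : Fin K → Fin Z → ZMod 3) (c : Fin K → ZMod 3) (g₀ : Fin K)
    (r : ZMod 3) : ℕ :=
  (univ.filter fun g => (γ g = γ g₀ ∧ c g = r) ∨ (γ g = -γ g₀ ∧ c g = -r)).card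

/-- R1-TRIVIALITY ("balanced"): in every parallel class the three signed-residue counts are pairwise
congruent mod 2 (then the class's tests cancel in pairs or group into full residue triples). -/
def Balanced {Z K : ℕ} (γ : Fin K → Fin Z → ZMod 3) (c : Fin K → ZMod 3) : Prop :=
  ∀ g₀ : Fin K, ∀ r s : ZMod 3, classCount γ c g₀ r % 2 = classCount γ c g₀ s % 2

/-- CLASS-TO-CUBE TRANSFER (ROUND-24 §2.3; arbitrary supports): if `4·3^K < Z` then an XOR of `K` tests that
is constant on a parity class is constant on the whole cube. -/
def ClassToCube : Prop :=
  ∀ (Z K σ : ℕ) (γ : Fin K → Fin Z → ZMod 3) (c : Fin K → ZMod 3), 4 * 3 ^ K < Z →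
    (∀ y ∈ parityClass Z σ, ∀ y' ∈ parityClass Z σ, xorTests γ c y = xorTests γ c y') →
      ∀ y y' : Fin Z → Bool, xorTests γ c y = xorTests γ c y'

/-- FULL-CUBE LEMMA (ROUND-24 §2.2): an XOR of `K < 2^(Z-1)` FULL-SUPPORT tests that is constant on the whole
cube `Fin Z → Bool` is balanced. (Sharp: the one extra relation uses all `2^(Z-1)` parallel classes.) -/
def FullCubeLemma : Prop :=
  ∀ (Z K : ℕ) (γ : Fin K → Fin Z → ZMod 3) (c : Fin K → ZMod 3),
    (∀ g e, γ g e ≠ 0) → K < 2 ^ (Z - 1) →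
    (∀ y y' : Fin Z → Bool, xorTests γ c y = xorTests γ c y') → Balanced γ c

/-- STRONG FULL-SUPPORT RIGIDITY (ROUND-24 §2.4, Theorem B): for `4·3^K < Z`, an XOR of `K` full-support
tests constant on a parity class is balanced — `m(Z) → ∞` with `m(Z) > log₃((Z-1)/4)`. -/
def StrongFullSupportRigidity : Prop :=
  ∀ (Z K σ : ℕ) (γ : Fin K → Fin Z → ZMod 3) (c : Fin K → ZMod 3),
    (∀ g e, γ g e ≠ 0) → 4 * 3 ^ K < Z →
    (∀ y ∈ parityClass Z σ, ∀ y' ∈ parityClass Z σ, xorTests γ c y = xorTests γ c y') →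
      Balanced γ c

/-! ### Glue (proved): the two lemmas give the strong theorem; the strong theorem gives the tree's
`FullSupportRigidity K₀ (4·3^K₀+1)`. -/

/-- `4·3^K < Z ⇒ K < 2^{Z−1}`. -/
private lemma lt_two_pow_pred {Z K : ℕ} (h : 4 * 3 ^ K < Z) : K < 2 ^ (Z - 1) := by
  have hK : K < 3 ^ K := Nat.lt_pow_self (by norm_num)
  have hZ : Z - 1 < 2 ^ (Z - 1) := Nat.lt_two_pow_self
  omega

/-- The two lemmas give the strong theorem. -/
theorem strong_of_lemmas (hA : ClassToCube) (hB : FullCubeLemma) : StrongFullSupportRigidity := by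
  intro Z K σ γ c hfull hZ hconst
  exact hB Z K γ c hfull (lt_two_pow_pred hZ) (hA Z K σ γ c hZ hconst)

/-- The strong theorem gives the tree's `FullSupportRigidity K₀ (4·3^K₀+1)`. -/
theorem fullSupportRigidity_of_strong (h : StrongFullSupportRigidity) (K₀ : ℕ) :
    FullSupportRigidity K₀ (4 * 3 ^ K₀ + 1) := by
  intro Z K σ hZ hK γ c g₀ hfull hlonely b
  -- `4·3^K < Z`
  have hZ' : 4 * 3 ^ K < Z := by
    have : 3 ^ K ≤ 3 ^ K₀ := Nat.pow_le_pow_right (by norm_num) hK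
    omega
  -- if the XOR were constant `= b` on the class, the system would be balanced; but the class of the
  -- lonely row `g₀` has counts `(1, 0, 0)`.
  by_contra hcon
  push Not at hcon
  have hconst : ∀ y ∈ parityClass Z σ, ∀ y' ∈ parityClass Z σ,
      xorTests γ c y = xorTests γ c y' := by
    intro y hy y' hy'
    rw [hcon y hy, hcon y' hy']
  have hbal := h Z K σ γ c hfull hZ' hconst g₀ (c g₀) (c g₀ + 1)
  -- γ g₀ ≠ -γ g₀ (full support, Z ≥ 1)
  have hZpos : 0 < Z := by omega
  have hne : γ g₀ ≠ -γ g₀ := by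
    intro heq
    have h0 := congrFun heq ⟨0, hZpos⟩
    have : γ g₀ ⟨0, hZpos⟩ = 0 := by
      have h3 : (γ g₀ ⟨0, hZpos⟩) + γ g₀ ⟨0, hZpos⟩ = 0 := by
        nth_rewrite 2 [h0]; simp
      revert h3; generalize γ g₀ ⟨0, hZpos⟩ = a; decide +revert
    exact hfull g₀ _ this
  have h1 : classCount γ c g₀ (c g₀) = 1 := by
    unfold classCount
    rw [Finset.card_eq_one]
    refine ⟨g₀, ?_⟩
    ext g
    simp only [mem_filter, mem_univ, true_and, mem_singleton]
    constructor
    · rintro (⟨hγ, _⟩ | ⟨hγ, _⟩)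
      · by_contra hg; exact hlonely g hg (Or.inl hγ)
      · by_contra hg; exact hlonely g hg (Or.inr hγ)
    · rintro rfl; exact Or.inl ⟨rfl, rfl⟩
  have h2 : classCount γ c g₀ (c g₀ + 1) = 0 := by
    unfold classCount
    rw [Finset.card_eq_zero, filter_eq_empty_iff]
    intro g _
    rintro (⟨hγ, hc⟩ | ⟨hγ, hc⟩)
    · by_cases hg : g = g₀
      · subst hg; revert hc; generalize c g = a; decide +revert
      · exact hlonely g hg (Or.inl hγ)
    · by_cases hg : g = g₀
      · subst hg; exact hne hγ
      · exact hlonely g hg (Or.inr hγ)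
  rw [h1, h2] at hbal
  norm_num at hbal

/-! ### ROUND-24 §2.10 (Theorem B′, LINEAR threshold): the Euler-recurrence route

On the class directly (no class-to-cube, no pigeonhole): with `F(δ) = Σ_{y∈T} ω^{⟨δ,y⟩}` one has the EULER RECURRENCE
`Σ_e ω^{δ_e} F(δ^{(e)}) = (τ + Σ_e ω^{δ_e}) F(δ)` (three lines) and antipodality `F(δ̄) = F(δ)²`; a zero of `F` never has
exactly one non-zero neighbour (β = 0 ⇒ `#supp F ≥ Z + 2`, covering argument) and, in the `β = 1` case `F = Π̄ + G`, every
zero has a non-zero neighbour (domination ⇒ `#supp ≥ 2^{Z-1}/(Z+1)`).  Hence for `Z ≥ 7` and `2K ≤ Z` a class-constant XOR of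
`K` full-support tests is balanced.  Together with the symmetric relations (Sketch25S: `K = Z` suffices for a relation) the
rigidity threshold is pinned to `K₀ ≤ Z₀*(K₀) ≤ max 7 (2K₀)`. -/

/-- THEOREM B′ (ROUND-24 §2.10, target): for `Z ≥ 7` and `2K ≤ Z`, an XOR of `K` full-support tests constant on a
parity class is balanced. Supersedes `StrongFullSupportRigidity` (`4·3^K < Z`). -/
def StrongFullSupportRigidityLin : Prop :=
  ∀ (Z K σ : ℕ) (γ : Fin K → Fin Z → ZMod 3) (c : Fin K → ZMod 3),
    (∀ g e, γ g e ≠ 0) → 7 ≤ Z → 2 * K ≤ Z →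
    (∀ y ∈ parityClass Z σ, ∀ y' ∈ parityClass Z σ, xorTests γ c y = xorTests γ c y') →
      Balanced γ c

/-- Glue (proved): Theorem B′ gives the tree's `FullSupportRigidity K₀ (max 7 (2·K₀))` for every `K₀`. -/
theorem fullSupportRigidity_of_lin (h : StrongFullSupportRigidityLin) (K₀ : ℕ) :
    FullSupportRigidity K₀ (max 7 (2 * K₀)) := by
  intro Z K σ hZ hK γ c g₀ hfull hlonely b
  have hZ7 : 7 ≤ Z := le_trans (le_max_left _ _) hZ
  have h2K : 2 * K ≤ Z := by
    have := le_trans (le_max_right 7 (2 * K₀)) hZ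
    omega
  by_contra hcon
  push Not at hcon
  have hconst : ∀ y ∈ parityClass Z σ, ∀ y' ∈ parityClass Z σ,
      xorTests γ c y = xorTests γ c y' := by
    intro y hy y' hy'
    rw [hcon y hy, hcon y' hy']
  have hbal := h Z K σ γ c hfull hZ7 h2K hconst g₀ (c g₀) (c g₀ + 1)
  have hZpos : 0 < Z := by omega
  have hne : γ g₀ ≠ -γ g₀ := by
    intro heq
    have h0 := congrFun heq ⟨0, hZpos⟩
    have : γ g₀ ⟨0, hZpos⟩ = 0 := by
      have h3 : (γ g₀ ⟨0, hZpos⟩) + γ g₀ ⟨0, hZpos⟩ = 0 := by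
        nth_rewrite 2 [h0]; simp
      revert h3; generalize γ g₀ ⟨0, hZpos⟩ = a; decide +revert
    exact hfull g₀ _ this
  have h1 : classCount γ c g₀ (c g₀) = 1 := by
    unfold classCount
    rw [Finset.card_eq_one]
    refine ⟨g₀, ?_⟩
    ext g
    simp only [mem_filter, mem_univ, true_and, mem_singleton]
    constructor
    · rintro (⟨hγ, _⟩ | ⟨hγ, _⟩)
      · by_contra hg; exact hlonely g hg (Or.inl hγ)
      · by_contra hg; exact hlonely g hg (Or.inr hγ)
    · rintro rfl; exact Or.inl ⟨rfl, rfl⟩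
  have h2 : classCount γ c g₀ (c g₀ + 1) = 0 := by
    unfold classCount
    rw [Finset.card_eq_zero, filter_eq_empty_iff]
    intro g _
    rintro (⟨hγ, hc⟩ | ⟨hγ, hc⟩)
    · by_cases hg : g = g₀
      · subst hg; revert hc; generalize c g = a; decide +revert
      · exact hlonely g hg (Or.inl hγ)
    · by_cases hg : g = g₀
      · subst hg; exact hne hγ
      · exact hlonely g hg (Or.inr hγ)
  rw [h1, h2] at hbal
  norm_num at hbal

end AffBells25

end Summit.QuantumAdvantage.AdviceFreeQNC0
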